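import Mathlib
import HarnessLib
import Summits.NavierStokesRegularity.NavierStokesRegularity.Theorems.HalfSpaceWindowDoorCirculationCarryingRigidityGaussRepresentation
import Summits.NavierStokesRegularity.NavierStokesRegularity.Theorems.HalfSpaceWindowDoorCirculationCarryingRigidityGaussExtremalFamily

/-!
# Route `HalfSpaceWindowDoor`, crux `CirculationCarryingRigidity` (stmt-NavierStokesRegularity-25311) —
# the INFLOW HISTORY of the Gaussian-extremal profile: the running `σ⁻²`-weighted inflow average peaks at the extremal time

LEAD ns-hsw-p1 g8 (cell pub-ns-dss), `--supports stmt-NavierStokesRegularity-25311 --as helper`; sequel of `…GaussRepresentation` (R⁺: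
`𝒢(s₀−s₁;x₀)[v(s₁)]/(s₀−s₁) = −½∫_{(−∞,s₁]} ℐ(s₀−σ;x₀)[v(σ)](s₀−σ)⁻² dσ`, sign-free) and `…GaussExtremalFamily` (normal form).  Along the
extremal characteristic (apex `0`, axis `0`) maximality `𝒢(−s₁;0)[W(s₁)] ≤ Λ` for EVERY `s₁ < 0`, with equality at `s₁ = −1`, is a GLOBAL-IN-TIME
statement about the inflow history `H(s₁) := ∫_{(−∞,s₁]} ℐ(−σ;0)[W(σ)] σ⁻² dσ`:

* `inflowHistory_of_extremal` — `H(−1) = −2Λ` and `H(s₁) ≥ −2Λ/(−s₁)` for all `s₁ < 0`; consequently (`intervalIntegral.integral_Iic_sub_Iic`)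
  **`∫_{s₁}^{−1} ℐ(−σ;0)[W(σ)] σ⁻² dσ ≤ −2Λ·(1 − 1/(−s₁))` for every `s₁ < −1`** and **`∫_{−1}^{s₁} ℐ σ⁻² dσ ≥ −2Λ·(1/(−s₁) − 1)` for every
  `s₁ ∈ (−1,0)`**.  Since `∫_{s₁}^{−1}σ⁻²dσ = 1 − 1/(−s₁)`: over EVERY window ending at the extremal time the `σ⁻²`-weighted AVERAGE of the
  inflow correlation is `≤ −2Λ = ℐ(1;0)[W(−1)]`, over the whole past it is exactly `−2Λ`, and over every window starting at the extremal
  time it is `≥ −2Λ`: the running weighted inflow average PEAKS at the extremal instant (first order: `ℐ(−1) = −2Λ`; second order: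
  `dℐ/dσ|_{−1} ≥ 0`, `…SecondOrder`) — the enemy's collapse about the extremal axis is paid by inflow that is, in weighted mean, at least
  as strong as the extremal one throughout every recent past window.  No sign hypothesis is needed for this file's theorem (the sign enters
  only the existence of the extremal `W`).
* `gaussExtremal_inflowHistory`, `circulationCarryingRigidity_of_inflowHistory` — the ∃-form for an enemy of W6 and the crux reduction.

WHAT THIS IS NOT: not a statement about Navier–Stokes regularity; door statements concern HYPOTHETICAL blow-up profiles (KNSS ancient
mild solutions).  No item is closed by this file.
-/

noncomputable section

-- the summit and its single sub-problem share the name (CONVENTIONS §1), as in every Theorems file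
set_option linter.dupNamespace false

namespace Summit.NavierStokesRegularity.NavierStokesRegularity.Theorems.HalfSpaceWindowDoorCirculationCarryingRigidityGaussExtremalInflowHistory

open MeasureTheory Set Function Filter Topology
open scoped RealInnerProductSpace InnerProductSpace
open Literature.Analysis Literature.Analysis.FluidPDE Literature.Analysis.UnboundedOperators
open Summit.NavierStokesRegularity.NavierStokesRegularity.Theses.HalfSpaceWindowDoor
open Summit.NavierStokesRegularity.NavierStokesRegularity.Theorems.HalfSpaceWindowDoorCirculationCarryingRigidityDefs
open Summit.NavierStokesRegularity.NavierStokesRegularity.Theorems.HalfSpaceWindowDoorCirculationCarryingRigidityReduction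
  (circulationCarryingRigidity_of_hemisphereLiouvilleE3)
open Summit.NavierStokesRegularity.NavierStokesRegularity.Theorems.HalfSpaceWindowDoorCirculationCarryingRigidityGaussRepresentation
  (gaussAngMom_eq_integral_inflow_holds)
open Summit.NavierStokesRegularity.NavierStokesRegularity.Theorems.HalfSpaceWindowDoorCirculationCarryingRigidityGaussExtremalFamily
  (exists_gaussExtremal')

variable {C : ℝ} {W : ℝ → EuclideanSpace ℝ (Fin 3) → EuclideanSpace ℝ (Fin 3)}

/-- **INFLOW HISTORY OF THE EXTREMAL PROFILE.**  For a door-class `W` with `𝒢(t;y₀)[W(σ)] ≤ Λ := 𝒢(1;0)[W(−1)]` for all `σ < 0`,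
`0 < t ≤ −σ`, `y₀` (Gaussian-extremal; no sign needed here), with `H(s₁) = ∫_{(−∞,s₁]} ℐ(0−σ;0)[W(σ)]/(0−σ)² dσ`:
the integrand is integrable on every `(−∞,s₁]`, `H(−1) = −2Λ`, `H(s₁) ≥ −2Λ/(0−s₁)` for all `s₁ < 0`, hence
`∫_{s₁}^{−1} ℐ/(0−σ)² ≤ −2Λ(1 − 1/(0−s₁))` for `s₁ < −1` and `∫_{−1}^{s₁} ℐ/(0−σ)² ≥ −2Λ(1/(0−s₁) − 1)` for `−1 < s₁ < 0`. -/
theorem inflowHistory_of_extremal (hW : InDoorClass C W)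
    (hmax : ∀ σ < 0, ∀ t : ℝ, 0 < t → t ≤ -σ → ∀ y₀, gaussAngMom t y₀ (W σ) ≤ gaussAngMom 1 0 (W (-1))) :
    (∀ s₁ < (0 : ℝ), IntegrableOn (fun σ => gaussInflow (0 - σ) 0 (W σ) / (0 - σ) ^ 2) (Iic s₁)) ∧
    (∫ σ in Iic (-1 : ℝ), gaussInflow (0 - σ) 0 (W σ) / (0 - σ) ^ 2) = -2 * gaussAngMom 1 0 (W (-1)) ∧
    (∀ s₁ < (0 : ℝ), -2 * gaussAngMom 1 0 (W (-1)) / (0 - s₁) ≤ ∫ σ in Iic s₁, gaussInflow (0 - σ) 0 (W σ) / (0 - σ) ^ 2) ∧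
    (∀ s₁ < (-1 : ℝ), ∫ σ in s₁..(-1), gaussInflow (0 - σ) 0 (W σ) / (0 - σ) ^ 2 ≤
      -2 * gaussAngMom 1 0 (W (-1)) * (1 - 1 / (0 - s₁))) ∧
    (∀ s₁ : ℝ, -1 < s₁ → s₁ < 0 → -2 * gaussAngMom 1 0 (W (-1)) * (1 / (0 - s₁) - 1) ≤
      ∫ σ in (-1)..s₁, gaussInflow (0 - σ) 0 (W σ) / (0 - σ) ^ 2) := by
  set Λ : ℝ := gaussAngMom 1 0 (W (-1)) with hΛ
  -- the representation along the apex-0 axis-0 characteristic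
  have hrep : ∀ s₁ < (0 : ℝ), IntegrableOn (fun σ => gaussInflow (0 - σ) 0 (W σ) / (0 - σ) ^ 2) (Iic s₁) ∧
      gaussAngMom (0 - s₁) 0 (W s₁) / (0 - s₁) = -(1 / 2) * ∫ σ in Iic s₁, gaussInflow (0 - σ) 0 (W σ) / (0 - σ) ^ 2 :=
    fun s₁ hs₁ => gaussAngMom_eq_integral_inflow_holds hW 0 hs₁ hs₁
  have hint : ∀ s₁ < (0 : ℝ), IntegrableOn (fun σ => gaussInflow (0 - σ) 0 (W σ) / (0 - σ) ^ 2) (Iic s₁) := fun s₁ hs₁ => (hrep s₁ hs₁).1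
  -- `H(−1) = −2Λ`
  have hH1 : (∫ σ in Iic (-1 : ℝ), gaussInflow (0 - σ) 0 (W σ) / (0 - σ) ^ 2) = -2 * Λ := by
    have h := (hrep (-1) (by norm_num)).2
    rw [show (0 : ℝ) - (-1) = 1 by norm_num, div_one] at h
    rw [hΛ]; linarith
  -- `H(s₁) ≥ −2Λ/(0 − s₁)` from maximality
  have hH : ∀ s₁ < (0 : ℝ), -2 * Λ / (0 - s₁) ≤ ∫ σ in Iic s₁, gaussInflow (0 - σ) 0 (W σ) / (0 - σ) ^ 2 := by
    intro s₁ hs₁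
    have hpos : 0 < 0 - s₁ := by linarith
    have h := (hrep s₁ hs₁).2
    have hm : gaussAngMom (0 - s₁) 0 (W s₁) ≤ Λ := hmax s₁ hs₁ (0 - s₁) hpos (by linarith) 0
    have hdiv : gaussAngMom (0 - s₁) 0 (W s₁) / (0 - s₁) ≤ Λ / (0 - s₁) := div_le_div_of_nonneg_right hm hpos.le
    rw [h] at hdiv
    have : -2 * Λ / (0 - s₁) = -2 * (Λ / (0 - s₁)) := by ring
    rw [this]; linarith
  refine ⟨hint, hH1, hH, fun s₁ hs₁ => ?_, fun s₁ hs₁ hs₁' => ?_⟩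
  · -- window ending at the extremal time
    have hs₁0 : s₁ < 0 := by linarith
    have hsub := intervalIntegral.integral_Iic_sub_Iic (hint s₁ hs₁0) (hint (-1) (by norm_num))
    rw [← hsub, hH1]
    have h := hH s₁ hs₁0
    have : -2 * Λ * (1 - 1 / (0 - s₁)) = -2 * Λ - -2 * Λ / (0 - s₁) := by ring
    rw [this]; linarith
  · -- window starting at the extremal time
    have hsub := intervalIntegral.integral_Iic_sub_Iic (hint (-1) (by norm_num)) (hint s₁ hs₁')
    rw [← hsub, hH1]
    have h := hH s₁ hs₁'
    have : -2 * Λ * (1 / (0 - s₁) - 1) = -2 * Λ / (0 - s₁) - -2 * Λ := by ring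
    rw [this]; linarith

/-- **THE EXTREMAL ENEMY'S INFLOW HISTORY.**  If some closed-hemisphere door-class profile (constant `C`) has `⟪curl v(s₁)(y₁), e₃⟫ > 0`
somewhere, there is a closed-hemisphere door-class `W` (constant `C`) with `Λ = 𝒢(1;0)[W(−1)] > 0`, maximal inflow `ℐ(1;0)[W(−1)] = −2Λ`,
and the inflow history of `inflowHistory_of_extremal`: whole-past weighted inflow `= −2Λ`, `≥ −2Λ/(−s₁)` up to every `s₁ < 0`,
`≤ −2Λ(1 − 1/(−s₁))` over every window `[s₁, −1]`, `≥ −2Λ(1/(−s₁) − 1)` over every window `[−1, s₁]`. -/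
theorem gaussExtremal_inflowHistory {v : ℝ → EuclideanSpace ℝ (Fin 3) → EuclideanSpace ℝ (Fin 3)} (hv : InDoorClass C v)
    (hsign : SignE3 v) (hpos : ∃ s < 0, ∃ y, 0 < ⟪curl (v s) y, e3⟫) :
    ∃ W : ℝ → EuclideanSpace ℝ (Fin 3) → EuclideanSpace ℝ (Fin 3), InDoorClass C W ∧ SignE3 W ∧
      0 < gaussAngMom 1 0 (W (-1)) ∧ gaussInflow 1 0 (W (-1)) = -2 * gaussAngMom 1 0 (W (-1)) ∧
      (∫ σ in Iic (-1 : ℝ), gaussInflow (0 - σ) 0 (W σ) / (0 - σ) ^ 2) = -2 * gaussAngMom 1 0 (W (-1)) ∧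
      (∀ s₁ < (0 : ℝ), -2 * gaussAngMom 1 0 (W (-1)) / (0 - s₁) ≤ ∫ σ in Iic s₁, gaussInflow (0 - σ) 0 (W σ) / (0 - σ) ^ 2) ∧
      (∀ s₁ < (-1 : ℝ), ∫ σ in s₁..(-1), gaussInflow (0 - σ) 0 (W σ) / (0 - σ) ^ 2 ≤
        -2 * gaussAngMom 1 0 (W (-1)) * (1 - 1 / (0 - s₁))) ∧
      (∀ s₁ : ℝ, -1 < s₁ → s₁ < 0 → -2 * gaussAngMom 1 0 (W (-1)) * (1 / (0 - s₁) - 1) ≤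
        ∫ σ in (-1)..s₁, gaussInflow (0 - σ) 0 (W σ) / (0 - σ) ^ 2) := by
  obtain ⟨W, hW, hWs, hΛ, hmax, hI⟩ := exists_gaussExtremal' hv hsign hpos
  obtain ⟨-, h1, h2, h3, h4⟩ := inflowHistory_of_extremal hW hmax
  exact ⟨W, hW, hWs, hΛ, hI, h1, h2, h3, h4⟩

/-- **The crux from the inflow history** (composition with the landed plumbing `stub_rotate`): it suffices to rule out closed-hemisphere
door-class profiles with `Λ > 0`, `ℐ(1;0)[W(−1)] = −2Λ` and `σ⁻²`-weighted inflow `≤ −2Λ(1 − 1/(−s₁))` over every window `[s₁,−1]`. -/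
theorem circulationCarryingRigidity_of_inflowHistory
    (h : ∀ (C : ℝ) (W : ℝ → EuclideanSpace ℝ (Fin 3) → EuclideanSpace ℝ (Fin 3)), InDoorClass C W → SignE3 W →
      0 < gaussAngMom 1 0 (W (-1)) → gaussInflow 1 0 (W (-1)) = -2 * gaussAngMom 1 0 (W (-1)) →
      (∀ s₁ < (-1 : ℝ), ∫ σ in s₁..(-1), gaussInflow (0 - σ) 0 (W σ) / (0 - σ) ^ 2 ≤
        -2 * gaussAngMom 1 0 (W (-1)) * (1 - 1 / (0 - s₁))) → False) :
    CirculationCarryingRigidity := by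
  refine circulationCarryingRigidity_of_hemisphereLiouvilleE3 ?_
  intro C v hrate hcont hmild hdiv hsign s hs y
  by_contra hne
  have hpos : 0 < ⟪curl (v s) y, e3⟫ := lt_of_le_of_ne (hsign s hs y) (Ne.symm hne)
  obtain ⟨W, hW, hWs, h0, hI, -, -, h3, -⟩ := gaussExtremal_inflowHistory (C := C) ⟨hrate, hcont, hmild, hdiv⟩ hsign ⟨s, hs, y, hpos⟩
  exact h C W hW hWs h0 hI h3


/-- **UNIFORM INFLOW BUDGET about EVERY space–time axis** (appended; maximality + the R⁺ representation at a general axis datum): for the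
Gaussian-extremal `W`, every axis `y₀`, every apex `s₀ ≤ 0` and every `s₁ < s₀`, the accumulated weighted inflow about `(y₀, s₀)` up to `s₁`
obeys `−2Λ/(s₀ − s₁) ≤ ∫_{(−∞,s₁]} ℐ(s₀−σ; y₀)[W(σ)]/(s₀−σ)² dσ` (`≤ 0` in the closed hemisphere, `integral_inflow_nonpos_holds`): no
characteristic ever accumulates more σ-weighted inflow than `2Λ/(s₀ − s₁)` (the class budget alone gives `12(4π)^{3/2}C²/(s₀ − s₁)`). -/
theorem inflowBudget_of_extremal (hW : InDoorClass C W)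
    (hmax : ∀ σ < 0, ∀ t : ℝ, 0 < t → t ≤ -σ → ∀ y₀, gaussAngMom t y₀ (W σ) ≤ gaussAngMom 1 0 (W (-1)))
    (y₀ : EuclideanSpace ℝ (Fin 3)) {s₀ s₁ : ℝ} (hs₀ : s₀ ≤ 0) (hs₁ : s₁ < s₀) :
    IntegrableOn (fun σ => gaussInflow (s₀ - σ) y₀ (W σ) / (s₀ - σ) ^ 2) (Iic s₁) ∧
      -2 * gaussAngMom 1 0 (W (-1)) / (s₀ - s₁) ≤ ∫ σ in Iic s₁, gaussInflow (s₀ - σ) y₀ (W σ) / (s₀ - σ) ^ 2 := by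
  have hs₁0 : s₁ < 0 := lt_of_lt_of_le hs₁ hs₀
  obtain ⟨hint, hrep⟩ := gaussAngMom_eq_integral_inflow_holds hW y₀ hs₁0 hs₁
  refine ⟨hint, ?_⟩
  have hpos : 0 < s₀ - s₁ := by linarith
  have hm : gaussAngMom (s₀ - s₁) y₀ (W s₁) ≤ gaussAngMom 1 0 (W (-1)) := hmax s₁ hs₁0 (s₀ - s₁) hpos (by linarith) y₀
  have hdiv : gaussAngMom (s₀ - s₁) y₀ (W s₁) / (s₀ - s₁) ≤ gaussAngMom 1 0 (W (-1)) / (s₀ - s₁) :=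
    div_le_div_of_nonneg_right hm hpos.le
  rw [hrep] at hdiv
  have : -2 * gaussAngMom 1 0 (W (-1)) / (s₀ - s₁) = -2 * (gaussAngMom 1 0 (W (-1)) / (s₀ - s₁)) := by ring
  rw [this]; linarith

end Summit.NavierStokesRegularity.NavierStokesRegularity.Theorems.HalfSpaceWindowDoorCirculationCarryingRigidityGaussExtremalInflowHistory

end
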